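import Literature.NumberTheory.EllipticCurves.GreenbergVatsal2000.EisensteinCongruenceTwisted
import Literature.NumberTheory.EllipticCurves.PAdicLFunctionMinus
import Literature.NumberTheory.EllipticCurves.ImaginaryPeriod
import Mathlib.NumberTheory.LegendreSymbol.QuadraticChar.Basic
import HarnessLib

/-!
# Greenberg–Vatsal 2000, §3 Thm. (3.12) with display (28), at the ODD quadratic character
# `χ = χ_{−p} = (·/p)` TAMELY RAMIFIED AT `p` (`p ≡ 3 (mod 4)`): the twisted Eisenstein congruence
# `L_{Σ₀}(E/ℚ, χ, T) ≡ U_χ(T) · L_{Σ₀}(C, χ, T) L_{Σ₀}(D, χ, (1+T)⁻¹ − 1) (mod πΛ)` for `E/ℚ` GOOD ORDINARY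
# at `p` with a rational `p`-isogeny whose kernel is ramified at `p` and ODD — filed through its
# consequence for the `μ`- and `λ`-invariants (named fact; the odd-sign twin of
# `thm311_quadraticTwist_hasUnitContent_iff_and_order_eq_of_lineRamifiedEven`)

HONEST FRAMING (cell `bsd-addord`, FULL-BSD rank-≤1 programme D-0033, seat `bsd-inputs-abimc-rf-p1`;
home `run/shared/lean/pub/bsd-addord/`): Literature = cited statements only. This file TYPES one
published NUMBERED statement as a named fact (`def … : Prop`, nothing asserted, no `_holds`):
Greenberg–Vatsal's Theorem (3.12) — their Thm. (3.11) "for forms with non-rational coefficients" and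
for "any Dirichlet character `χ` with conductor prime to `N`, and with `χ(−1) = −ψ(−1)`" (p. 45) —
specialised to the elliptic-curve newform `f = f_E` (`E` GOOD ORDINARY at `p`, so `N` is prime to `p`
and `ρ_m` is `p`-distinguished) and to the ONE character the cell's additive rows at `p ≡ 3 (mod 4)`
need: the ODD quadratic character `χ = (·/p) = ω^{(p−1)/2}` of `K = ℚ(√−p) ⊂ ℚ(μ_p)` (conductor `p`,
prime to `N`). The sibling `thm311_quadraticTwist_hasUnitContent_iff_and_order_eq_of_lineRamifiedEven`
(`EisensteinCongruenceTwisted.lean`, p396680) is the EVEN case `p ≡ 1 (mod 4)` (GV Thm. (3.11), "any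
even character"); the `-- TODO(general form)` of `EisensteinCongruenceResidualBranch.lean` names the
present statement ("GV's Thm. (3.12) is stated for any `p`-ordinary weight-2 eigenform … and any `χ`
of conductor prime to `N` with `χ(−1) = −ψ(−1)`; only … `χ = ω^{(p−1)/2}` [with the residual
identifications folded in] is filed"). Nothing about elliptic curves is asserted; every consumer takes
this `Prop` as an explicit hypothesis. BSD is not proved by any of this.

WHY (reach, not mathematics): with the two character sentences of GV pp. 41–42 at a twist
(`characterLFunctionC/D_hasUnitContent_and_order_eq_card_of_…`, `CharacterInvariantsTwisted.lean`)
this fact and its even sibling give the READING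
`thm312_branch_unitContent_and_lambda_eq_residual_goodOrd` (route K1 `AdditiveBranchIMC`, crux
ReadingFacts, child 19297) by KERNEL glue (`Summits/…/Theorems/AdditiveBranchIMCGreenbergVatsalResidualBranchOfPrint*.lean`).

## Citation header (held author PDF = arXiv:math/9906215, Invent. Math. 142 (2000) 17–63; cell copy
## `run/shared/lean/pub/bsd-addord/lit/greenbergvatsal2000/txt-author-pdf/p00NN.txt`, NN = page;
## page-checked again in the cell's audit sheet `HOME/audit/D-AUDIT-19361-stub_gvBranch.md`, rows B, C1, C3)

* p. 44 ("Modular forms with non-rational coefficients"): "let `f = Σ a_n q^n` denote a weight 2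
  eigenform on `Γ₁(N)`, with coefficients in the `p`-adic integer ring `O`. … We assume as usual that
  `N` is divisible by at most the first power of `p`, and that `a_p` is a unit in `O`. … the characters
  `φ` and `ψ` are distinct when restricted to the decomposition group `D_p`. Such a representation is
  said to be `p`-distinguished … This condition will always be satisfied if, for instance, the level `N`
  is prime to `p`. With the assumption that `ρ_m` is `p`-distinguished, we single out the character
  `ψ` by requiring that it be unramified, and that it satisfy `ψ(Frob(p)) = a_p` in `F^×`. Let `α = ±`
  be the choice of sign determined by `−ψ(−1) = ±1`."
* p. 45: "Let `χ` be any Dirichlet character with conductor prime to `N`, and with `χ(−1) = −ψ(−1)`.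
  We may choose `O` large enough to contain the values of `χ`. Let `Σ₀` denote any finite set of
  primes, with `p ∉ Σ₀`, and containing all other primes `q ≠ p` dividing `N`. As in the proof of
  Theorem (3.11), we obtain the following result: **Theorem (3.12)** Assume that `ρ_m` is
  `p`-distinguished. Then there exists an invertible power series `U_χ(T)` such that the following
  congruence holds: `L_{Σ₀}(f, χ, T) ≡ U_χ(T) · L_{Σ₀}(χφω⁻¹, T) · L_{Σ₀}(χ⁻¹ψ⁻¹, (1+T)⁻¹ − 1) (mod πΛ)`.
  Thus, the invariant `μ^{anal}_f` is trivial. The main conjecture is true for `f`. Here the period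
  appearing in `L_{Σ₀}(f, χ, T)` is the canonical period `Ω^α_g` attached to the eigenform `g`
  obtained from `f` by dropping all Euler factors in `Σ₀`."
* p. 39 (24): "`L(f, χ, ζ − 1) = τ(χ⁻¹ρ⁻¹) · α_p(f)^{−m} · L(f, χρ, 1)/((−2πi)Ω^α_f)` … The sign `α`
  is determined by `±1 = χ(−1)`. … The `p`-adic `L`-function of an elliptic curve is defined in a
  similar manner. Namely, one takes the `p`-adic `L`-function of the corresponding modular form `f`,
  and specifies the period by replacing `(−2πi)Ω^α_f` with the Néron period `Ω^α_E`."
* p. 41 (26): "`L_p(χωψ⁻¹, s) = L(C, χ, κ(γ)^{−s} − 1)` … (`ωψ⁻¹ = φ`)"; p. 42 (27): "`L_p(ωχ⁻¹ψ⁻¹, s)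
  = ½ L(D, χ, κ(γ)^s − 1)` … Euler factors `1 − χψ(l)l⁻¹(1 + T)^{f_l}`"; (28):
  "`L(G, χ, T) = L_{Σ₀}(C, χ, T) L_{Σ₀}(D, χ, T)`".
* PERIOD STEP (admissible sign, every member of the isogeny class). Lemma (3.6) p. 37: "Let `f` be a
  newform of level `N` …, corresponding to the modular elliptic curve `E`. Assume that `E` has ordinary
  reduction at `p`, and let `g` … be the eigenform, of level `M`, obtaining from `f` by removing all
  Euler factors at primes `q ≠ p` such that `q ∣ N`. Then, if `α` is an admissible sign for `E`, the
  canonical periods `Ω^α_f` and `Ω^α_g` are equal up to `p`-adic unit." Its proof, p. 38: "we let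
  `E^{min}` denote the minimal curve in the isogeny class `𝒜` of `E` and `B` constructed by Stevens …
  if `A ∈ 𝒜`, there exists an étale isogeny `ϕ : E^{min} → A`. If `α` is an admissible sign, it follows
  from the definitions that the kernel of `ϕ` has parity `−α` for the action of complex conjugation.
  This implies that the periods `Ω^α_A` and `Ω^α_{E^{min}}` coincide." Prop. (3.1) p. 34: "Assume that
  `E` is optimal in its isogeny class, and that `p` is a prime of either good ordinary or multiplicative
  reduction for `E`. Then the numbers `Ω^α_E` and `(−2πi)Ω^α_f` are equal up to a factor which is a
  `p`-adic unit." (Used by GV for a general `Σ₀` on p. 41, p. 43 and p. 45 "As in the proof of Theorem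
  (3.11)"; cell audit rows C3 (i)–(iii): the admissible sign at `χ = (·/p)`, `p ≡ 3 (mod 4)`, is
  `α = χ(−1) = −`.)

## The tree's vocabulary (no new definition) and the reading

Exactly as in the even sibling, with the parities swapped: `V/ℚ` globally minimal, `p ≠ 2` with
`p ≡ 3 (mod 4)`, GOOD ORDINARY at `p`; `Φ₀ ≤ V[p]` a rational line RAMIFIED at `p` (its character is
GV's ramified constituent `φ = ωψ⁻¹`, so the complementary constituent `ψ` is the unramified one with
`ψ(Frob p) = a_p`) and ODD (`φ(−1) = −1`, i.e. `ψ` EVEN and `χ(−1) = −1 = −ψ(−1)`: Thm. (3.12)'s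
parity hypothesis at the odd `χ`), with primitive characters `φ` mod `m` (on `Φ₀`) and `ψ` mod `d` (on
`V[p]/Φ₀`) valued in `𝔽_p`; `f` the newform of `V`; `S₀ = Σ₀ ∌ p` finite ⊇ bad places `≠ p` of `V`;
`χ := quadraticChar (ZMod p)` read in `𝔽_p` (the Legendre symbol `(·/p)`, odd as `(−1/p) = −1`);
`W` ANY globally minimal model of the twist `V^{(−p)} = V ⊗ χ` (`p* = −p`; it enters only through its
Euler factors at `S₀`: those of `L(V ⊗ χ, s)` at `l ∈ Σ₀`, tree `eulerFactorProduct W p S₀`); `ϖ ∈ ℚ`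
with `ϖ · |Ω⁻(V)| = Ω⁻_f` (admissible sign `α = χ(−1) = −`: the IMAGINARY Néron period,
tree `imaginaryPeriodRat` / `minusPeriod`); `B := padicLFunctionMinusBranch f (unitRoot V p) ((p−1)/2)`,
the `ω^{(p−1)/2}`-branch of the Mazur–Swinnerton-Dyer measure on the MINUS modular symbols
(`(p−1)/2 = p / 2` is odd; MTT §I.13), and `b ∈ Λ` with `ι b = ϖ · B`. READING of "`L_{Σ₀}(f, χ, T)`
with the period `Ω^α_g`" as `b · ∏𝒫_ℓ` up to a `p`-adic unit and the orientation of `T`: (24) with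
the Néron period `Ω⁻_V` in place of `(−2πi)Ω⁻_f` (p. 39), the period step Prop. (3.1) + Lemma (3.6)
(proof, p. 38) + "the period appearing … is `Ω^α_g`" (p. 45) for the admissible sign `−`, and the
Gauss-sum / `ρ ↦ ρ⁻¹` units — the statement is filed ONLY through the consequence for the reductions
mod `p` (unit content and `ord_T(· mod p)`), which is invariant under units of `Λ`, under
`T ↦ (1+T)⁻¹ − 1` and under the invertible `U_χ(T)`. The two Kubota–Leopoldt factors: by (26)
`L_{Σ₀}(χφω⁻¹, ·)` is the function of `CharacterPAdicLFunctions.lean` for the EVEN character `χφ`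
(`IsCharacterLFunctionC p (χ·φ) S₀`, modulus `p·m`), and by (27)/p. 42 `L_{Σ₀}(χ⁻¹ψ⁻¹, (1+T)⁻¹ − 1)`
is that file's `D`-function for the ODD character `χψ` (`IsCharacterLFunctionD p (ψ·χ) S₀`, modulus
`d·p`) — the same presentations as the even sibling. TRANSCRIBED FOR GOOD ORDINARY `p` ONLY.
`-- TODO(general form): any χ with (cond χ, N) = 1 and χ(−1) = −ψ(−1) for any p-ordinary weight-2`
`-- eigenform on Γ₁(N) with coefficients in O (GV Thm. (3.12) as printed); multiplicative p; the`
`-- congruence itself with the invertible U_χ(T) rather than its μ/λ consequence.`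
-/

noncomputable section

open scoped Classical MatrixGroups ModularForm

open NumberField IsDedekindDomain Field WeierstrassCurve CongruenceSubgroup PowerSeries
open Literature.NumberTheory.EllipticCurves Literature.NumberTheory.GaloisRepresentations
  Literature.NumberTheory.EllipticCurves.ModularForms
  Literature.NumberTheory.EllipticCurves.Rank1Residual

namespace Literature.NumberTheory.EllipticCurves.GreenbergVatsal2000

/-- **Greenberg–Vatsal 2000, §3 Thm. (3.12) with display (28), at `χ = (·/p)` (`p ≡ 3 (mod 4)`, so
`χ` is ODD and tamely ramified at `p`), good ordinary `p`: the twisted Eisenstein congruence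
`L_{Σ₀}(E/ℚ, χ, T) ≡ U_χ(T) · L_{Σ₀}(C, χ, T) · L_{Σ₀}(D, χ, (1+T)⁻¹ − 1) (mod πΛ)`.** Thm. (3.12),
p. 45: "Let `χ` be any Dirichlet character with conductor prime to `N`, and with `χ(−1) = −ψ(−1)`. …
Assume that `ρ_m` is `p`-distinguished. Then there exists an invertible power series `U_χ(T)` such
that the following congruence holds:
`L_{Σ₀}(f, χ, T) ≡ U_χ(T) · L_{Σ₀}(χφω⁻¹, T) · L_{Σ₀}(χ⁻¹ψ⁻¹, (1+T)⁻¹ − 1) (mod πΛ)`. … Here the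
period appearing in `L_{Σ₀}(f, χ, T)` is the canonical period `Ω^α_g`", in the set-up of p. 44 ("`ψ`
… unramified, … `ψ(Frob(p)) = a_p` … `α = ±` … determined by `−ψ(−1) = ±1`"; "`p`-distinguished …
always … satisfied if … `N` is prime to `p`"), with (26) p. 41 "`L_p(χωψ⁻¹, s) = L(C, χ, κ(γ)^{−s} − 1)`",
(27) p. 42 "`L_p(ωχ⁻¹ψ⁻¹, s) = ½ L(D, χ, κ(γ)^s − 1)`", (24) p. 39 (sign `±1 = χ(−1)`; "replacing
`(−2πi)Ω^α_f` with the Néron period `Ω^α_E`") and the period step for the admissible sign and every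
member of the isogeny class: Prop. (3.1) p. 34, Lemma (3.6) p. 37 with its proof p. 38 ("there exists
an étale isogeny `ϕ : E^{min} → A`. If `α` is an admissible sign, … the kernel of `ϕ` has parity `−α`
… This implies that the periods `Ω^α_A` and `Ω^α_{E^{min}}` coincide"). TRANSCRIPTION: `V/ℚ`
globally minimal, `p ≠ 2`, `p ≡ 3 (mod 4)`, GOOD ORDINARY at `p`; `Φ₀` a rational line ramified at `p`
and ODD (its character `φ` is odd, the unramified constituent `ψ` is even, `χ(−1) = −1 = −ψ(−1)`) with
primitive characters `φ` mod `m` (on `Φ₀`) and `ψ` mod `d` (on `V[p]/Φ₀`), valued in `𝔽_p`; `f` the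
newform; `S₀ ∌ p` finite ⊇ bad places `≠ p`; `W` a globally minimal model of the twist
`V^{(−p)} = V ⊗ χ` (Euler factors at `S₀` of `L(V, χ, s)`); `ϖ · |Ω⁻(V)| = Ω⁻_f` (admissible sign
minus); `b ∈ Λ` with `ι b = ϖ · padicLFunctionMinusBranch f α ((p−1)/2)` (`α` the unit root; the
`χ = ω^{(p−1)/2}`-branch of the Mazur–Swinnerton-Dyer measure, MINUS symbols) — `b · ∏𝒫_ℓ(W)`
represents `L_{Σ₀}(V/ℚ, χ, T)` up to orientation of `T` and units; `g_C`, `g_D` ANY solutions of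
`IsCharacterLFunctionC p (χ·φ) S₀` (modulus `p·m`; `χφ` even) and `IsCharacterLFunctionD p (ψ·χ) S₀`
(modulus `d·p`; `χψ` odd), `χ = quadraticChar` valued in `𝔽_p`: then `b · ∏𝒫_ℓ` has unit content iff
`g_C · g_D` does, and in that case `ord_T((b·∏𝒫_ℓ) mod p) = ord_T((g_C·g_D) mod p)` — insensitive to
`U_χ`, to `T ↦ (1+T)⁻¹ − 1` and to units. The odd-sign twin of
`thm311_quadraticTwist_hasUnitContent_iff_and_order_eq_of_lineRamifiedEven`. Named fact; nothing
asserted.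
-- TODO(general form): any χ with conductor prime to N and χ(−1) = −ψ(−1), any p-ordinary weight-2
-- eigenform on Γ₁(N) (GV Thm. (3.12)); multiplicative p; the congruence with the invertible U_χ(T).
[cite: GreenbergVatsal2000, §3 Thm. (3.12) (p. 45) with p. 44 (set-up), (24) p. 39, (26)–(28) pp. 41–42, Prop. (3.1) p. 34, Lemma (3.6) pp. 37–38] -/
def thm312_quadraticTwistOdd_hasUnitContent_iff_and_order_eq_of_lineRamifiedOdd : Prop :=
  ∀ (V : WeierstrassCurve ℚ) [V.IsGloballyMinimal] [V.IsElliptic] (p : ℕ) [Fact p.Prime]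
    (W : WeierstrassCurve ℚ) [W.IsGloballyMinimal] [W.IsElliptic]
    {N : ℕ} [NeZero N] (f : CuspForm (Gamma0 N) 2)
    (S₀ : Finset (HeightOneSpectrum (𝓞 ℚ)))
    (Φ₀ : AddSubgroup (V.geomTorsion (p : ℤ)))
    (m : ℕ) [NeZero m] (φ : DirichletCharacter (ZMod p) m)
    (d : ℕ) [NeZero d] (ψ : DirichletCharacter (ZMod p) d),
    p ≠ 2 → p % 4 = 3 →
    (V.HasGoodReductionAtPrime p ∧ ¬ (p : ℤ) ∣ V.frobeniusTrace p) →
    (∃ C : VariableChange ℚ, C • V.quadraticTwist (-(p : ℚ)) = W) →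
    IsRationalLine V p Φ₀ → ¬ LineUnramifiedAt V p Φ₀ → LineOdd V p Φ₀ → IsNewformOf V f →
    φ.IsPrimitive → ψ.IsPrimitive →
    (∀ (σ : absoluteGaloisGroup ℚ), ∀ P ∈ Φ₀,
      σ • P = (φ ((modNCyclotomicCharacter ℚ m σ : (ZMod m)ˣ) : ZMod m)).val • P) →
    (∀ (σ : absoluteGaloisGroup ℚ) (P : V.geomTorsion (p : ℤ)),
      σ • P - (ψ ((modNCyclotomicCharacter ℚ d σ : (ZMod d)ˣ) : ZMod d)).val • P ∈ Φ₀) →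
    (∀ v ∈ S₀, ((p : ℕ) : 𝓞 ℚ) ∉ v.asIdeal) →
    (∀ v : HeightOneSpectrum (𝓞 ℚ), v ∉ S₀ → ((p : ℕ) : 𝓞 ℚ) ∉ v.asIdeal →
      V.HasGoodReductionAt v) →
    ∀ (ϖ : ℚ), (ϖ : ℝ) * V.imaginaryPeriodRat = minusPeriod f →
    ∀ (b : IwasawaAlgebra p),
      iwasawaToPowerSeries p b =
        PowerSeries.C ((ϖ : ℚ) : ℚ_[p]) *
          padicLFunctionMinusBranch f ((unitRoot V p : ℤ_[p]) : ℚ_[p]) (p / 2) →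
    ∀ (gC gD : IwasawaAlgebra p),
      IsCharacterLFunctionC p
        (DirichletCharacter.changeLevel (dvd_mul_right p m)
            ((quadraticChar (ZMod p)).ringHomComp (Int.castRingHom (ZMod p))) *
          DirichletCharacter.changeLevel (dvd_mul_left m p) φ) S₀ gC →
      IsCharacterLFunctionD p
        (DirichletCharacter.changeLevel (dvd_mul_right d p) ψ *
          DirichletCharacter.changeLevel (dvd_mul_left p d)
            ((quadraticChar (ZMod p)).ringHomComp (Int.castRingHom (ZMod p)))) S₀ gD →
      (HasUnitContent (b * eulerFactorProduct W p S₀) ↔ HasUnitContent (gC * gD)) ∧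
        (HasUnitContent (gC * gD) →
          (PowerSeries.map (PadicInt.toZMod (p := p)) (b * eulerFactorProduct W p S₀)).order =
            (PowerSeries.map (PadicInt.toZMod (p := p)) (gC * gD)).order)

end Literature.NumberTheory.EllipticCurves.GreenbergVatsal2000

end
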